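import Mathlib.Analysis.SpecificLimits.Normed
import Mathlib.Analysis.SpecialFunctions.Exp
import Mathlib.Analysis.SpecialFunctions.Exponential
import Literature.NumberTheory.LFunctions.MoebiusHarmonicSumBound
import HarnessLib

/-!
# Census assembly of the line `pedigree-perpetuity` — real-analysis constants
# (crux `EnergyCurrentTails`, stmt-AtomisticToContinuum-9235)

Support file (`--supports stmt-AtomisticToContinuum-9235`) of the registered stub `stub_censusAssembly`
(lead c3 worker), elementary real analysis only (no kinetic objects):

* tail-to-quartic conversions `e^{-y} ≤ 24 / y⁴` (the tree's
  `Literature.NumberTheory.LFunctions.MoebiusSum.exp_neg_le_div_pow_four`, reused) and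
  `k⁴ ρᵏ ≤ K(ρ)` for `0 ≤ ρ < 1` (`exists_bound_pow_four_mul_pow`);
* the discounted thermal allowance `Σ_{g<g₁} (1-δ)^g (m+g+2) ≤ (m+2)/δ + 1/δ²`
  (`sum_discounted_allowance_le`);
* the choice of the run allowance `m = m(L)` with `(m+2)/δ + 1/δ² ≤ L/3` and `m + 2 ≥ δL/6`
  (`exists_runAllowance`), of the block horizon `g₁` with `(1-δ)^{g₁} (A + x) ≤ x/3`
  (`exists_blockHorizon`), and the logic of the total-energy channel (`le_of_discount_le`);
* the integer third `⌊L/3⌋` of a natural level (`third_level`).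

All statements are registered-helper style (`∀`-form where they are the file's main theorem).
-/

open Filter Finset
open scoped BigOperators Topology

namespace Summit.AtomisticToContinuum.HydrodynamicLimit.Theorems.EnergyCurrentTailsPedigree

/-- For `0 ≤ ρ < 1` the sequence `k⁴ ρᵏ` is bounded: `∃ K ≥ 0, ∀ k, k⁴ ρᵏ ≤ K`. -/
theorem exists_bound_pow_four_mul_pow {ρ : ℝ} (h0 : 0 ≤ ρ) (h1 : ρ < 1) :
    ∃ K : ℝ, 0 ≤ K ∧ ∀ k : ℕ, (k : ℝ) ^ 4 * ρ ^ k ≤ K := by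
  have ht := tendsto_pow_const_mul_const_pow_of_abs_lt_one 4 (show |ρ| < 1 by
    rwa [abs_of_nonneg h0])
  obtain ⟨K, hK⟩ := ht.bddAbove_range
  refine ⟨max K 0, le_max_right _ _, fun k => ?_⟩
  exact (hK ⟨k, rfl⟩).trans (le_max_left _ _)

/-- **Discounted thermal allowance**: for `0 < δ ≤ 1`,
`Σ_{g<g₁} (1-δ)^g (m+g+2) ≤ (m+2)/δ + 1/δ²` (geometric and arithmetico-geometric series). -/
theorem sum_discounted_allowance_le {δ : ℝ} (hδ : 0 < δ) (hδ1 : δ ≤ 1) (m g₁ : ℕ) :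
    ∑ g ∈ Finset.range g₁, (1 - δ) ^ g * ((m + g + 2 : ℕ) : ℝ)
      ≤ ((m : ℝ) + 2) / δ + 1 / δ ^ 2 := by
  set r : ℝ := 1 - δ with hr
  have hr0 : 0 ≤ r := by rw [hr]; linarith
  have hr1 : r < 1 := by rw [hr]; linarith
  have hnorm : ‖r‖ < 1 := by rwa [Real.norm_of_nonneg hr0]
  have hgeo : Summable fun g : ℕ => r ^ g := summable_geometric_of_lt_one hr0 hr1
  have hag : Summable fun g : ℕ => (g : ℝ) * r ^ g := by
    simpa using summable_pow_mul_geometric_of_norm_lt_one 1 hnorm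
  have hsplit : ∀ g ∈ Finset.range g₁, (1 - δ) ^ g * ((m + g + 2 : ℕ) : ℝ)
      = ((m : ℝ) + 2) * r ^ g + (g : ℝ) * r ^ g := by
    intro g _
    push_cast
    ring
  rw [Finset.sum_congr rfl hsplit, Finset.sum_add_distrib, ← Finset.mul_sum]
  have h1 : ∑ g ∈ Finset.range g₁, r ^ g ≤ 1 / δ := by
    calc ∑ g ∈ Finset.range g₁, r ^ g ≤ ∑' g, r ^ g :=
          hgeo.sum_le_tsum _ fun g _ => pow_nonneg hr0 g
      _ = (1 - r)⁻¹ := tsum_geometric_of_lt_one hr0 hr1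
      _ = 1 / δ := by rw [hr, sub_sub_cancel, one_div]
  have h2 : ∑ g ∈ Finset.range g₁, (g : ℝ) * r ^ g ≤ 1 / δ ^ 2 := by
    calc ∑ g ∈ Finset.range g₁, (g : ℝ) * r ^ g ≤ ∑' g : ℕ, (g : ℝ) * r ^ g :=
          hag.sum_le_tsum _ fun g _ => mul_nonneg (Nat.cast_nonneg g) (pow_nonneg hr0 g)
      _ = r / (1 - r) ^ 2 := tsum_coe_mul_geometric_of_norm_lt_one hnorm
      _ = r / δ ^ 2 := by rw [hr, sub_sub_cancel]
      _ ≤ 1 / δ ^ 2 := div_le_div_of_nonneg_right hr1.le (by positivity)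
  have hm : 0 ≤ (m : ℝ) + 2 := by positivity
  calc ((m : ℝ) + 2) * ∑ g ∈ Finset.range g₁, r ^ g + ∑ g ∈ Finset.range g₁, (g : ℝ) * r ^ g
      ≤ ((m : ℝ) + 2) * (1 / δ) + 1 / δ ^ 2 := add_le_add (mul_le_mul_of_nonneg_left h1 hm) h2
    _ = ((m : ℝ) + 2) / δ + 1 / δ ^ 2 := by ring

/-- **Choice of the run allowance** `m = m(L)`: for `0 < δ` and `L ≥ (6/δ)(1/δ + 1)` there is a
natural `m` with `(m+2)/δ + 1/δ² ≤ L/3` (the allowance side condition) and `m + 2 ≥ δL/6`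
(linear growth, for the geometric run price). -/
theorem exists_runAllowance {δ : ℝ} (hδ : 0 < δ) {L : ℝ}
    (hL : 6 / δ * (1 / δ + 1) ≤ L) :
    ∃ m : ℕ, ((m : ℝ) + 2) / δ + 1 / δ ^ 2 ≤ L / 3 ∧ δ * L / 6 ≤ (m : ℝ) + 2 := by
  have hkey : 6 * (1 / δ + 1) ≤ δ * L := by
    have := mul_le_mul_of_nonneg_left hL hδ.le
    rwa [← mul_assoc, mul_div_cancel₀ _ hδ.ne'] at this
  have hy : 0 ≤ δ * L / 3 - 1 / δ - 2 := by
    have h1 : 0 < 1 / δ := by positivity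
    nlinarith
  refine ⟨⌊δ * L / 3 - 1 / δ - 2⌋₊, ?_, ?_⟩
  · have hfl : (⌊δ * L / 3 - 1 / δ - 2⌋₊ : ℝ) ≤ δ * L / 3 - 1 / δ - 2 := Nat.floor_le hy
    have h3 : ((⌊δ * L / 3 - 1 / δ - 2⌋₊ : ℝ) + 2) + 1 / δ ≤ δ * (L / 3) := by linarith
    rw [div_add_div _ _ hδ.ne' (by positivity), div_le_iff₀ (by positivity)]
    have h1 : 0 < 1 / δ := by positivity
    have : (((⌊δ * L / 3 - 1 / δ - 2⌋₊ : ℝ) + 2) + 1 / δ) * δ ^ 2 ≤ δ * (L / 3) * δ ^ 2 :=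
      mul_le_mul_of_nonneg_right h3 (by positivity)
    have h1d : 1 / δ * δ ^ 2 = δ := by field_simp
    nlinarith
  · have hfl : δ * L / 3 - 1 / δ - 2 < (⌊δ * L / 3 - 1 / δ - 2⌋₊ : ℝ) + 1 := Nat.lt_floor_add_one _
    have h1 : 0 < 1 / δ := by positivity
    nlinarith

/-- **Choice of the block horizon** `g₁`: for `0 < δ`, `x > 0`, `A ≥ 0` there is `g₁` with
`(1-δ)^{g₁} (A + x) ≤ x / 3`. -/
theorem exists_blockHorizon {δ : ℝ} (hδ : 0 < δ) {x A : ℝ} (hx : 0 < x)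
    (hA : 0 ≤ A) : ∃ g₁ : ℕ, (1 - δ) ^ g₁ * (A + x) ≤ x / 3 := by
  have hAx : 0 < A + x := by linarith
  obtain ⟨g₁, hg⟩ := exists_pow_lt_of_lt_one (show 0 < x / 3 / (A + x) by positivity)
    (show 1 - δ < 1 by linarith)
  refine ⟨g₁, ?_⟩
  have := (lt_div_iff₀ hAx).1 hg
  simpa [hδ] using this.le

/-- **Logic of the total-energy channel**: if `(1-δ)^{g₁}(A + x) ≤ x/3`, `δ < 1` and
`x/3 ≤ (1-δ)^{g₁} E`, then `A + x ≤ E`. -/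
theorem le_of_discount_le {δ : ℝ} (hδ1 : δ < 1) {x A E : ℝ} {g₁ : ℕ}
    (hg : (1 - δ) ^ g₁ * (A + x) ≤ x / 3) (hE : x / 3 ≤ (1 - δ) ^ g₁ * E) : A + x ≤ E := by
  by_contra h
  have h : E < A + x := lt_of_not_ge h
  have hp : 0 < (1 - δ) ^ g₁ := pow_pos (by linarith) _
  have : (1 - δ) ^ g₁ * E < (1 - δ) ^ g₁ * (A + x) := mul_lt_mul_of_pos_left h hp
  linarith

/-- **The integer third of a level**: for a natural `L ≥ 3`, `L' := L / 3` satisfies `1 ≤ L'`,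
`L' ≤ L/3` (as reals) and `L ≤ 9 L'`. -/
theorem third_level {L : ℕ} (hL : 3 ≤ L) :
    1 ≤ L / 3 ∧ ((L / 3 : ℕ) : ℝ) ≤ (L : ℝ) / 3 ∧ (L : ℝ) ≤ 9 * ((L / 3 : ℕ) : ℝ) := by
  refine ⟨by omega, Nat.cast_div_le, ?_⟩
  have h3 : L ≤ 9 * (L / 3) := by omega
  exact_mod_cast h3


/-- **Geometric price of the run channel**: `Σ_{g<g₁} C ρ^{m+g+2} ≤ C ρ^{m+2} / (1-ρ)` for `C ≥ 0`,
`0 ≤ ρ < 1`. -/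
theorem sum_run_price_le {C ρ : ℝ} (hC : 0 ≤ C) (h0 : 0 ≤ ρ) (h1 : ρ < 1) (m g₁ : ℕ) :
    ∑ g ∈ Finset.range g₁, C * ρ ^ (m + g + 2) ≤ C * ρ ^ (m + 2) / (1 - ρ) := by
  have hgeo : Summable fun g : ℕ => ρ ^ g := summable_geometric_of_lt_one h0 h1
  have hrw : ∀ g ∈ Finset.range g₁, C * ρ ^ (m + g + 2) = C * ρ ^ (m + 2) * ρ ^ g := by
    intro g _
    rw [show m + g + 2 = (m + 2) + g by omega, pow_add, mul_assoc]
  rw [Finset.sum_congr rfl hrw, ← Finset.mul_sum, div_eq_mul_inv]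
  refine mul_le_mul_of_nonneg_left ?_ (by positivity)
  calc ∑ g ∈ Finset.range g₁, ρ ^ g ≤ ∑' g, ρ ^ g := hgeo.sum_le_tsum _ fun g _ => pow_nonneg h0 g
    _ = (1 - ρ)⁻¹ := tsum_geometric_of_lt_one h0 h1

/-- A geometric run price decays like `L⁻⁴`: if `k⁴ ρᵏ ≤ K` for all `k` and `δL/6 ≤ m + 2` with
`L ≥ 1`, then `ρ^{m+2} ≤ K 6⁴ / (δ⁴ L⁴)`. -/
theorem run_price_le_quartic {ρ K δ L : ℝ} {m : ℕ} (hK : ∀ k : ℕ, (k : ℝ) ^ 4 * ρ ^ k ≤ K)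
    (h0 : 0 ≤ ρ) (hδ : 0 < δ) (hL : 1 ≤ L) (hm : δ * L / 6 ≤ (m : ℝ) + 2) :
    ρ ^ (m + 2) ≤ K * 6 ^ 4 / (δ ^ 4 * L ^ 4) := by
  have hk := hK (m + 2)
  push_cast at hk
  have hpos : 0 < δ * L / 6 := by positivity
  have hm2 : 0 < (m : ℝ) + 2 := by positivity
  have h1 : ρ ^ (m + 2) ≤ K / ((m : ℝ) + 2) ^ 4 := by
    rw [le_div_iff₀ (by positivity)]; linarith [mul_comm (ρ ^ (m + 2)) (((m : ℝ) + 2) ^ 4)]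
  have hK0 : 0 ≤ K := le_trans (by positivity) hk
  have h2 : K / ((m : ℝ) + 2) ^ 4 ≤ K / (δ * L / 6) ^ 4 := by
    refine div_le_div_of_nonneg_left hK0 (by positivity) ?_
    exact pow_le_pow_left₀ hpos.le hm 4
  refine h1.trans (h2.trans_eq ?_)
  field_simp

/-- An exponential price decays like `L⁻⁴`: `e^{-(L a)/b} ≤ 24 (b/a)⁴ / L⁴` for `a, b, L > 0`. -/
theorem exp_price_le_quartic {a b L : ℝ} (ha : 0 < a) (hb : 0 < b) (hL : 0 < L) :
    Real.exp (-(L * a) / b) ≤ 24 * (b / a) ^ 4 / L ^ 4 := by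
  have hy : 0 < L * a / b := by positivity
  have h := Literature.NumberTheory.LFunctions.MoebiusSum.exp_neg_le_div_pow_four hy
  rw [neg_div] 
  refine h.trans_eq ?_
  field_simp

/-- **The constants of the census assembly.**  Given the parameters of the four channels
(`δ ∈ (0,1)`, thermal threshold `Θ₀ > 0`, data temperature `Θ* > 0`, run price `C_r ρ₁ⁿ` with
`0 ≤ ρ₁ < 1`, merge price `B₁ L⁻⁵`, data tail constant `C_d ≥ 0`, energetic level `Θe`), there are a
level threshold `L₀ ≥ 3` and ONE constant `B ≥ 0` such that: (small levels) `n ≤ B n / L⁴` for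
`1 ≤ L ≤ L₀`; (time zero) `C_d n e^{-LΘ₀/Θ*} / (LΘ₀) ≤ B n / L⁴` for `L ≥ 1`; (positive times) for
`L ≥ L₀`: `3Θe ≤ LΘ₀`, and a run allowance `m` with the discounted-allowance side condition for every
block horizon `g₁` such that the sum of the four channel prices is at most `B n / L⁴`. -/
theorem census_constants : ∀ {δ Θ₀ Θs Cr ρ₁ Cd : ℝ}, 0 < δ → δ < 1 → 0 < Θ₀ → 0 < Θs → 0 ≤ Cr →
    0 ≤ ρ₁ → ρ₁ < 1 → 0 ≤ Cd → ∀ (B₁ Θe : ℝ), ∃ L₀ : ℝ, 3 ≤ L₀ ∧ ∃ B : ℝ, 0 ≤ B ∧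
      (∀ L : ℕ, 1 ≤ L → (L : ℝ) ≤ L₀ → ∀ n : ℝ, 0 ≤ n → n ≤ B * n / (L : ℝ) ^ 4) ∧
      (∀ L : ℕ, 1 ≤ L → ∀ n : ℝ, 0 ≤ n →
        Cd * n * Real.exp (-((L : ℝ) * Θ₀) / Θs) / ((L : ℝ) * Θ₀) ≤ B * n / (L : ℝ) ^ 4) ∧
      (∀ L : ℕ, L₀ ≤ (L : ℝ) → 3 * Θe ≤ (L : ℝ) * Θ₀ ∧ ∃ m : ℕ,
        (∀ g₁ : ℕ, Θ₀ * (∑ g ∈ Finset.range g₁, (1 - δ) ^ g * ((m + g + 2 : ℕ) : ℝ))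
            ≤ (L : ℝ) * Θ₀ / 3) ∧
        ∀ n : ℝ, 0 ≤ n →
          n * (Cr * ρ₁ ^ (m + 2) / (1 - ρ₁) + max B₁ 0 / ((L / 3 : ℕ) : ℝ) ^ 5
              + Real.exp (-((L : ℝ) * Θ₀) / Θs))
            + Cd * n * Real.exp (-((L : ℝ) * Θ₀ / 3) / Θs) / ((L : ℝ) * Θ₀ / 3)
            ≤ B * n / (L : ℝ) ^ 4) := by
  intro δ Θ₀ Θs Cr ρ₁ Cd hδ hδ1 hΘ₀ hΘs hCr hρ0 hρ1 hCd B₁ Θe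
  obtain ⟨K, hK0, hK⟩ := exists_bound_pow_four_mul_pow hρ0 hρ1
  -- the level threshold
  set L₀ : ℝ := max (max 3 (3 * Θe / Θ₀)) (6 / δ * (1 / δ + 1)) with hL₀
  have hL₀3 : 3 ≤ L₀ := (le_max_left _ _).trans' (le_max_left _ _)
  have hL₀e : 3 * Θe / Θ₀ ≤ L₀ := (le_max_left _ _).trans' (le_max_right _ _)
  have hL₀δ : 6 / δ * (1 / δ + 1) ≤ L₀ := le_max_right _ _
  -- the constants of the six pieces
  set Bs : ℝ := L₀ ^ 4 with hBs
  set BD : ℝ := 24 * (Θs / Θ₀) ^ 4 with hBD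
  set B0 : ℝ := Cd / Θ₀ * BD with hB0
  set BR : ℝ := Cr / (1 - ρ₁) * (K * 6 ^ 4 / δ ^ 4) with hBR
  set BΛ : ℝ := max B₁ 0 * 9 ^ 5 with hBΛ
  set BI : ℝ := Cd / (Θ₀ / 3) * (24 * (Θs / (Θ₀ / 3)) ^ 4) with hBI
  have h1ρ : 0 < 1 - ρ₁ := by linarith
  have hBs0 : 0 ≤ Bs := by positivity
  have hB00 : 0 ≤ B0 := by positivity
  have hBR0 : 0 ≤ BR := by positivity
  have hBΛ0 : 0 ≤ BΛ := by positivity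
  have hBD0 : 0 ≤ BD := by positivity
  have hBI0 : 0 ≤ BI := by positivity
  refine ⟨L₀, hL₀3, Bs + B0 + (BR + BΛ + BD + BI), by positivity, ?_, ?_, ?_⟩
  · -- small levels
    intro L hL hLL n hn
    have hL1 : (1 : ℝ) ≤ L := by exact_mod_cast hL
    have hL4 : (L : ℝ) ^ 4 ≤ Bs := by rw [hBs]; exact pow_le_pow_left₀ (by positivity) hLL 4
    rw [le_div_iff₀ (by positivity)]
    calc n * (L : ℝ) ^ 4 ≤ n * Bs := mul_le_mul_of_nonneg_left hL4 hn
      _ ≤ n * (Bs + B0 + (BR + BΛ + BD + BI)) := by gcongr; linarith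
      _ = _ := by ring
  · -- time zero
    intro L hL n hn
    have hL1 : (1 : ℝ) ≤ L := by exact_mod_cast hL
    have hLpos : (0 : ℝ) < L := by linarith
    have hexp := exp_price_le_quartic hΘ₀ hΘs hLpos
    calc Cd * n * Real.exp (-((L : ℝ) * Θ₀) / Θs) / ((L : ℝ) * Θ₀)
        ≤ Cd * n * (24 * (Θs / Θ₀) ^ 4 / (L : ℝ) ^ 4) / (1 * Θ₀) := by
          gcongr
    _ = B0 * n / (L : ℝ) ^ 4 := by rw [hB0, hBD]; field_simp
    _ ≤ _ := by
          rw [div_le_div_iff_of_pos_right (by positivity)]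
          refine mul_le_mul_of_nonneg_right ?_ hn
          linarith
  · -- positive times
    intro L hLL
    have hL3 : (3 : ℝ) ≤ L := hL₀3.trans hLL
    have hL1 : (1 : ℝ) ≤ L := by linarith
    have hLpos : (0 : ℝ) < L := by linarith
    have hLnat : 3 ≤ L := by exact_mod_cast hL3
    refine ⟨?_, ?_⟩
    · have := (div_le_iff₀ hΘ₀).1 (hL₀e.trans hLL)
      linarith
    obtain ⟨m, hm1, hm2⟩ := exists_runAllowance hδ (hL₀δ.trans hLL)
    refine ⟨m, fun g₁ => ?_, fun n hn => ?_⟩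
    · have h := sum_discounted_allowance_le hδ hδ1.le m g₁
      calc Θ₀ * (∑ g ∈ Finset.range g₁, (1 - δ) ^ g * ((m + g + 2 : ℕ) : ℝ))
          ≤ Θ₀ * ((L : ℝ) / 3) := mul_le_mul_of_nonneg_left (h.trans hm1) hΘ₀.le
        _ = _ := by ring
    -- the four prices
    obtain ⟨hq1, hq2, hq3⟩ := third_level hLnat
    have hq0 : (0 : ℝ) < ((L / 3 : ℕ) : ℝ) := by exact_mod_cast hq1
    have hPR : Cr * ρ₁ ^ (m + 2) / (1 - ρ₁) ≤ BR / (L : ℝ) ^ 4 := by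
      have h := run_price_le_quartic hK hρ0 hδ hL1 hm2
      calc Cr * ρ₁ ^ (m + 2) / (1 - ρ₁) ≤ Cr * (K * 6 ^ 4 / (δ ^ 4 * (L : ℝ) ^ 4)) / (1 - ρ₁) := by
            gcongr
        _ = BR / (L : ℝ) ^ 4 := by rw [hBR]; field_simp
    have hPΛ : max B₁ 0 / ((L / 3 : ℕ) : ℝ) ^ 5 ≤ BΛ / (L : ℝ) ^ 4 := by
      have h5 : (L : ℝ) ^ 5 ≤ (9 * ((L / 3 : ℕ) : ℝ)) ^ 5 := pow_le_pow_left₀ hLpos.le hq3 5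
      calc max B₁ 0 / ((L / 3 : ℕ) : ℝ) ^ 5 = max B₁ 0 * 9 ^ 5 / (9 * ((L / 3 : ℕ) : ℝ)) ^ 5 := by
            field_simp
        _ ≤ max B₁ 0 * 9 ^ 5 / (L : ℝ) ^ 5 :=
            div_le_div_of_nonneg_left (by positivity) (by positivity) h5
        _ ≤ max B₁ 0 * 9 ^ 5 / (L : ℝ) ^ 4 := by
            refine div_le_div_of_nonneg_left (by positivity) (by positivity) ?_
            calc (L : ℝ) ^ 4 = (L : ℝ) ^ 4 * 1 := (mul_one _).symm
              _ ≤ (L : ℝ) ^ 4 * L := mul_le_mul_of_nonneg_left hL1 (by positivity)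
              _ = (L : ℝ) ^ 5 := by ring
        _ = BΛ / (L : ℝ) ^ 4 := by rw [hBΛ]
    have hPD : Real.exp (-((L : ℝ) * Θ₀) / Θs) ≤ BD / (L : ℝ) ^ 4 := by
      rw [hBD]; exact exp_price_le_quartic hΘ₀ hΘs hLpos
    have hPI : Cd * n * Real.exp (-((L : ℝ) * Θ₀ / 3) / Θs) / ((L : ℝ) * Θ₀ / 3)
        ≤ BI * n / (L : ℝ) ^ 4 := by
      have hΘ3 : 0 < Θ₀ / 3 := by positivity
      have hexp := exp_price_le_quartic hΘ3 hΘs hLpos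
      have hrw : (L : ℝ) * Θ₀ / 3 = (L : ℝ) * (Θ₀ / 3) := by ring
      rw [hrw]
      calc Cd * n * Real.exp (-((L : ℝ) * (Θ₀ / 3)) / Θs) / ((L : ℝ) * (Θ₀ / 3))
          ≤ Cd * n * (24 * (Θs / (Θ₀ / 3)) ^ 4 / (L : ℝ) ^ 4) / (1 * (Θ₀ / 3)) := by
            gcongr
        _ = BI * n / (L : ℝ) ^ 4 := by rw [hBI]; field_simp
    calc n * (Cr * ρ₁ ^ (m + 2) / (1 - ρ₁) + max B₁ 0 / ((L / 3 : ℕ) : ℝ) ^ 5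
            + Real.exp (-((L : ℝ) * Θ₀) / Θs))
          + Cd * n * Real.exp (-((L : ℝ) * Θ₀ / 3) / Θs) / ((L : ℝ) * Θ₀ / 3)
        ≤ n * (BR / (L : ℝ) ^ 4 + BΛ / (L : ℝ) ^ 4 + BD / (L : ℝ) ^ 4) + BI * n / (L : ℝ) ^ 4 := by
          gcongr
    _ = (BR + BΛ + BD + BI) * n / (L : ℝ) ^ 4 := by ring
    _ ≤ _ := by
          rw [div_le_div_iff_of_pos_right (by positivity)]
          refine mul_le_mul_of_nonneg_right ?_ hn
          linarith

end Summit.AtomisticToContinuum.HydrodynamicLimit.Theorems.EnergyCurrentTailsPedigree
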